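import Literature.Barriers.HodgeConjecture.NormalFunctionsProofs
import Literature.AlgebraicGeometry.HodgeTheory.UniversalHypersurfaceHodgeLociOfGriffiths
import HarnessLib

/-!
# The barrier fact `Voisin2003_generalHypersurface_noIntegralClassInF` from Griffiths' theorem and the
# infinitesimal Noether–Lefschetz step — Lemma 5.13 discharged

Proof file (no definition, no named fact) for the barrier `Literature/Barriers/HodgeConjecture/NormalFunctions`
(Voisin, *Hodge Theory II*, Lemma 8.18: for a very general hypersurface of large degree there is no
non-zero integral class in `F^{k-1}H^{2k-1}`). `NormalFunctionsProofs` reduced the fact to the two analytic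
hypotheses of the universal family — `hclimb` (Cor. 5.17 + Thm. 6.13 + Macaulay) and `hcl` (Lemma 5.13,
closedness of the Hodge loci of flat classes) — in
`Voisin2003_generalHypersurface_noIntegralClassInF_of_climb_of_closed`. With Lemma 5.13 now a THEOREM of
the tree granted Griffiths' holomorphy of the Hodge bundles
(`UniversalHypersurface.isInHodgeFiltration_of_mem_closure_of_griffiths1968`, from the general named fact
`Griffiths1968_holomorphicHodgeSubbundles`), the barrier fact rests on {Griffiths 1968, `hclimb`} alone:
`Voisin2003_generalHypersurface_noIntegralClassInF_of_griffiths1968_of_climb`. Seat hodge-nonav 20241-p1 g12.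

## References

* [VoisinHodgeII2003] C. Voisin, Hodge Theory and Complex Algebraic Geometry II, CUP (2003), Lemma 8.18
  (proof), Thm. 6.24 (statement and proof), Cor. 5.17, Lemma 5.13.
* [VoisinHodgeI2002] C. Voisin, Hodge Theory and Complex Algebraic Geometry I, CUP (2002), §10.2.1 Thm. 10.3.
-/

noncomputable section

open _root_.Topology _root_.Filter

namespace Literature.Barriers.HodgeConjecture

open Literature.AlgebraicGeometry.HodgeTheory
open Literature.AlgebraicGeometry.Motives
open Literature.AlgebraicTopology.SingularHomology

/-- **The barrier fact from Griffiths' theorem (Voisin I Thm. 10.3) and the infinitesimal Noether–Lefschetz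
step (Voisin II Cor. 5.17 ∕ Thm. 6.13) for the universal family in the levels `k-1 ≤ p ≤ 2k-1`, for all
large `d`** — `Voisin2003_generalHypersurface_noIntegralClassInF_of_climb_of_closed` with its second
hypothesis (Lemma 5.13) discharged by
`UniversalHypersurface.exists_isSmoothHypersurface_forall_isIntegralClass_imp_eq_zero_of_climb_of_griffiths1968`.
[cite: VoisinHodgeII2003, Lemma 8.18 (proof), Thm. 6.24 (statement and proof), Cor. 5.17 and Lemma 5.13]
[cite: VoisinHodgeI2002, §10.2.1 Thm. 10.3] -/
theorem Voisin2003_generalHypersurface_noIntegralClassInF_of_griffiths1968_of_climb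
    (hG : Griffiths1968_holomorphicHodgeSubbundles)
    (h : ∀ k : ℕ, 2 ≤ k → ∃ d₀ : ℕ, ∀ d : ℕ, d₀ ≤ d →
      ∀ (B : Set (universalHypersurfaceBasePoints (2 * k - 1) d)), IsOpen B →
        ∀ (ξ : singularCohomology ℂ ℂ
            (tubeOver (Literature.AlgebraicGeometry.Motives.UniversalHypersurface.family ℂ (2 * k - 1) d) B)
            (2 * k - 1)) (p : ℕ), k - 1 ≤ p → p ≤ 2 * k - 1 →
        ∀ (u : universalHypersurfaceBasePoints (2 * k - 1) d) (hu : u ∈ B),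
          (∀ᶠ u' in 𝓝 u, ∃ hu' : u' ∈ B,
            IsInHodgeFiltration (2 * k - 1)
              (fiberOver (Literature.AlgebraicGeometry.Motives.UniversalHypersurface.family ℂ (2 * k - 1) d) u')
              (2 * k - 1) p
              (fiberRestrict (Literature.AlgebraicGeometry.Motives.UniversalHypersurface.family ℂ (2 * k - 1) d)
                hu' (2 * k - 1) ξ)) →
          IsInHodgeFiltration (2 * k - 1)
            (fiberOver (Literature.AlgebraicGeometry.Motives.UniversalHypersurface.family ℂ (2 * k - 1) d) u)
            (2 * k - 1) (p + 1)
            (fiberRestrict (Literature.AlgebraicGeometry.Motives.UniversalHypersurface.family ℂ (2 * k - 1) d)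
              hu (2 * k - 1) ξ)) :
    Voisin2003_generalHypersurface_noIntegralClassInF := by
  refine Voisin2003_generalHypersurface_noIntegralClassInF_of_NL₁ fun k hk ↦ ?_
  obtain ⟨d₀, hd₀⟩ := h k hk
  refine ⟨max d₀ 1, fun d hd ↦ ?_⟩
  have hclimb := hd₀ d ((le_max_left _ _).trans hd)
  exact UniversalHypersurface.exists_isSmoothHypersurface_forall_isIntegralClass_imp_eq_zero_of_climb_of_griffiths1968
    (2 * k - 1) d hG (by omega) ((le_max_right _ _).trans hd) (by omega) hclimb

end Literature.Barriers.HodgeConjecture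

end
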